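import Mathlib
import HarnessLib
import HarnessLib.Audit
import Summits.PneNP.PneNP.Theses.SymmetryBudget
import Literature.Computability.Complexity.SymmetricCircuit
import Summits.PneNP.PneNP.Theorems.SymmetryBudgetWindowBarrierCoreReduction
import Summits.PneNP.PneNP.Theorems.SymmetryBudgetWindowBarrierStubHeaderHardwiring
import Summits.PneNP.PneNP.Theorems.SymmetryBudgetWindowBarrierStubAddressableBitLanguage
import Summits.PneNP.PneNP.Theorems.WindowBarrier.Negative.BudgetZero
import Summits.PneNP.PneNP.Theorems.WindowBarrier.Negative.InvarianceAndBridge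

/-!
# Line `young-transport-plan` — crux `SymmetryBudget.WindowBarrier` (stmt-PneNP-2145)

Crux (fixed, route `route-PneNP-SymmetryBudget`, rank 4): there is `L ∈ P` whose graph slices
`x ↦ [encode ⟨m, Gr x⟩ ∈ L]` are `Bud(m,⌊log₂ m⌋)`-invariant and, for every polynomial `p`, infinitely
often have no `Bud(m,⌊log₂ m⌋)`-symmetric threshold circuit of size `≤ p(m)`.

Idea (crux idea card `Ideas/young-transport-plan.md`, triage r1-2 / r1-3: pass). Work on the free
part only (`n`-vertex graphs, FULL symmetry `Sym(Fin n)`, size `2^{cn}`; `n = ⌊log₂ m⌋`, so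
`poly(m) = 2^{O(n)}`): by the lead's LANDED core reduction (`Theorems.stub_coreReduction`, p77230)
and the picked line's header machinery (S2 `Theorems.stub_addressableBitLanguage` p76488, S3
`Theorems.stub_headerHardwiring` p74277, composition `windowBarrier_restated`), the crux follows from
a complete invariant in `FP` (Babai–Luks, literature debt) and the SQUARE-SYMMETRIC CORE (★): for
every `d`, infinitely often two non-isomorphic `n`-vertex graphs fool every `Sym(n)`-symmetric
`tcBasis` circuit of size `≤ 2^{dn}`. This line says what such a pair IS and splits (★) in two:

* **What a window circuit can index.** A gate of a `Sym(n)`-symmetric circuit of size `≤ 2^{cn}`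
  has a stabiliser of index `≤ 2^{cn}`, which by the ENTROPY SUPPORT THEOREM (`stub_entropySupport`,
  permutation-group theory; shared in substance with `Lines/entropy-support-dichotomy` `stub_est`)
  contains `∏ᵢ Alt(Bᵢ)` for the classes `Bᵢ` of a LOW-ENTROPY labelling `μ : Fin n → ℕ`
  (multinomial `n!/∏|Bᵢ|! ≤ 2^{Kn}`, `K = K(c)`). So all input-dependence of all window circuits
  lives on ONE fixed homogeneous scheme: the `Sym(n)`-set `𝒱_K` of low-entropy labellings, with
  input `G` entering only through the QUOTIENT LABELS `quot G μ` (edge counts between classes).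
* **The dual object.** Colour refinement on that labelled scheme has an exact LP dual (fractional
  isomorphism, Tinhofer / Ramana–Scheinerman–Ullman), and the LP's symmetry algebra is
  `ρ(ℝ[Sym n])` (orbital matrices span `End_{Sym(n)}`; double centraliser). Unfolded: `G₁`, `G₂`
  are window-indistinguishable iff there is a SIGNED TRANSPORT PLAN `a : Sym(n) → ℚ` of total mass
  `1` whose mass on every transporter `{σ | σ • μ = ν}` between low-entropy labellings is `≥ 0`, and
  `= 0` unless `quot G₁ ν = quot G₂ μ` (`IsYoungPlan`; an honest isomorphism is the point-mass
  plan). `stub_refinementBound` (D1 of the card) is the soundness half actually needed here: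
  `EntropySupport →` (a Young-positive plan at rate `K(c)` fools every symmetric circuit of size
  `≤ 2^{cn}`) — the block/Young analogue of "fractional isomorphism ⇒ `C²`-equivalence ⇒ equal
  values of support-2 symmetric circuits" (Anderson–Dawar 2017 Thm 6, point version PROVED in tree).
* **The open core, dualised.** `stub_youngTransport` (K1 of the card, HARDEST): for every rate `K`,
  infinitely often two NON-isomorphic `n`-vertex graphs admit a Young-positive signed transport plan.
  Dimension count: `n! = 2^{n log n}` unknowns `a σ` against `2^{O(Kn)}` coset constraints; only the
  long-first-row / long-first-column isotypics of `a` are pinned (Young's rule), every other Fourier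
  coefficient is free — the room a witness needs exactly where CFI-type gauge GROUPS provably have
  none (BN1–BN3: one bisection transporter carries negative mass).

Composition (kernel-checked, no `sorry` outside the four stubs):
`stub_youngTransport → (stub_refinementBound stub_entropySupport) → (★)` (`coreFooling_of`, filter
bookkeeping) `→ S4` (`Theorems.stub_coreReduction`, landed) `→ WindowBarrier` (`windowBarrier_restated`:
the picked line's composition over `stub_completeInvariant` = S1, landed S2, landed S3).

Stubs (4, registered by `ledger skeleton check`):
* `stub_youngTransport`   — K1, OPEN CORE (hardest): Young-positive signed plans between non-isomorphic graphs, every rate.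
* `stub_entropySupport`   — EST in multinomial form (L; Praeger–Saxl/Maróti + Dixon–Mortimer 5.2B; = entropy line's `stub_est` + Stirling).
* `stub_refinementBound`  — D1: `EntropySupport →` plans at rate `K(c)` fool symmetric circuits of size `2^{cn}` (L/XL; NEW).
* `stub_completeInvariant` — S1 of the picked line: a complete invariant in `FP` for `Bud`-isomorphism (Babai–Luks 1983 + landing S1b plumbing; literature debt, SHARED).

Certificate layer (NOT stubs; stated as `def`s for the lead / cdisprove, §Certificates): `TransportDuality`
(plan ⟺ colour-refinement equivalence of the labelled Young scheme, provable now, M/L) and `PlanOrSeparate`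
(D2: no plan at rate `K` ⇒ an explicit symmetric separating circuit of size `2^{O(Kn)}` — the Farkas /
kill-switch direction: a "Young positivstellensatz" at one `K₀` refutes (★) at `c(K₀)` and with it S4 and
`stub_witness` of both sibling lines, while the crux itself stays open).

Disproof.lean (v8, read 2026-08-16) has no `_false_without_` theorem; honoured: `not_windowBarrierAt_zero` /
`windowBarrierAt_false_of_factorial_le` (symmetry load-bearing — used in `stub_refinementBound`, and at
budget 0 a plan degenerates to a point mass on an isomorphism, so `stub_youngTransport` has no budget-0
analogue), `windowBarrier_without_invariance` (invariance load-bearing — carried by landed S2 for all `m`),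
F4 (`∃ᶠ`, kept), T0–T3 (`Fools.*`: the core pairs live on the free part, all ordered data equal). Landed
`Theorems/WindowBarrier/Negative/{BudgetZero,InvarianceAndBridge}.lean` are IMPORTED above: no stub is an
instance they refute (they concern budget `0`, `g! ≤ poly`, and non-invariant slices).
-/

-- `Summit.PneNP.PneNP.…` duplicates `PneNP` BY DESIGN (single-problem summit, D-0017).
set_option linter.dupNamespace false

noncomputable section

namespace Summit.PneNP.PneNP.Cruxes.WindowBarrier.YoungTransportPlan

open Literature.Computability.Complexity Filter Finset
open scoped Classical BigOperators

/-! ## Vocabulary (transparent definitions over Mathlib; nothing here is an item) -/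

/-- Size of the class of label `i` under a labelling `μ : Fin n → ℕ` (a labelling encodes an ORDERED
partition of `Fin n`: classes ordered by label value). -/
@[folklore] def classSize {n : ℕ} (μ : Fin n → ℕ) (i : ℕ) : ℕ :=
  (univ.filter fun u : Fin n => μ u = i).card

/-- **Low entropy at rate `K`**: the multinomial coefficient of the labelling is at most `2^{Kn}`,
`n! ≤ 2^{Kn} · ∏_{classes} |class|!` — exactly "the `Sym(n)`-orbit of `μ` has size `≤ 2^{Kn}`", i.e.
the Young subgroup of `μ` has index `≤ 2^{Kn}`: the shapes a window circuit can afford to index.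
Examples at `K = 1`: one class (`0` bits), a bisection (`C(n,n/2) ≤ 2ⁿ`), `k ≤ n/log₂ n` singletons
plus one big class (`≤ n^k`); NOT affordable at any fixed `K`: all singletons (`n!`). -/
@[folklore] def LowEntropy (K n : ℕ) (μ : Fin n → ℕ) : Prop :=
  n.factorial ≤ 2 ^ (K * n) * ∏ i ∈ univ.image μ, (classSize μ i).factorial

/-- **Quotient label** of a graph by a labelling: the number of ORDERED pairs `(u, v)` with `u` in
class `i`, `v` in class `j` and `u ~ v` (the quotient / class-incidence matrix of `G` by `μ`, as a
finitely supported function `ℕ → ℕ → ℕ`). This is the only place the input enters. -/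
@[folklore] def quot {n : ℕ} (G : SimpleGraph (Fin n)) (μ : Fin n → ℕ) (i j : ℕ) : ℕ :=
  (univ.filter fun p : Fin n × Fin n => μ p.1 = i ∧ μ p.2 = j ∧ G.Adj p.1 p.2).card

/-- **Transporter mass** of a signed measure `a` on `Sym(Fin n)`: `a {σ | σ • μ = ν}`, where
`(σ • μ) (σ u) = μ u` (the labelling `μ` pushed forward along `σ`). For labellings of one shape the
transporter is a left/right translate `τ_ν · Young(λ) · τ_μ⁻¹` of the Young subgroup. -/
@[folklore] def mass {n : ℕ} (a : Equiv.Perm (Fin n) → ℚ) (μ ν : Fin n → ℕ) : ℚ :=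
  ∑ σ ∈ univ.filter (fun σ : Equiv.Perm (Fin n) => ∀ u : Fin n, ν (σ u) = μ u), a σ

/-- **Young-positive signed transport plan** from `G₂` to `G₁` at entropy rate `K`: a signed measure
`a` on `Sym(Fin n)` of total mass `1` whose mass on every transporter out of a low-entropy labelling
is non-negative, and zero when the quotient labels disagree (`quot G₁ ν ≠ quot G₂ μ`). The point
mass at an isomorphism `σ₀ : G₂ ≃g G₁` is a plan (`quot G₁ (σ₀ • μ) = quot G₂ μ`); by the transport
duality (§Certificates) a plan exists iff colour refinement on the labelled Young scheme
`(𝒱_K, overlap types, quot)` does not separate `G₁` from `G₂` — a Sherali–Adams-type relaxation of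
isomorphism whose local views are low-entropy QUOTIENTS instead of `k`-tuples (`k`-WL = the shapes
`(1^k, n-k)`). -/
@[folklore] def IsYoungPlan (K n : ℕ) (G₁ G₂ : SimpleGraph (Fin n))
    (a : Equiv.Perm (Fin n) → ℚ) : Prop :=
  (∑ σ : Equiv.Perm (Fin n), a σ = 1) ∧
    ∀ μ ν : Fin n → ℕ, LowEntropy K n μ →
      0 ≤ mass a μ ν ∧ (quot G₁ ν ≠ quot G₂ μ → mass a μ ν = 0)

/-- `G₁ ≡_K G₂`: a Young-positive signed transport plan at rate `K` exists. -/
@[folklore] def YoungEquiv (K n : ℕ) (G₁ G₂ : SimpleGraph (Fin n)) : Prop :=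
  ∃ a : Equiv.Perm (Fin n) → ℚ, IsYoungPlan K n G₁ G₂ a

/-! ## The four statements of the line -/

/-- **K1 · YoungTransport (the open core, dualised).** For every entropy rate `K`, for infinitely
many `n`, two NON-isomorphic `n`-vertex graphs admit a Young-positive signed transport plan at rate
`K`. Necessary features of a witness (provable filters, card P3 / BN8 / triage r1-3): equal
multisets `{quot G μ}` over every low-entropy shape (round 0: e.g. equal numbers of independent
bisections, equal Potts/Ising partition functions into `≤ 2^K` states), `C^{k}`-equivalence for
`k ≈ Kn/log₂ n` (the shapes `(1^k, n-k)` are low-entropy), agreement on all materialised monadic tests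
(lead's MonadicTests). Known dead: every Duplicator that is a GROUP of vertex permutations of order
`2^{o(n)}` (CFI, ℤ_q-CFI, multipedes, lifts): positivity fails on the transporter of one generic
bisection (BN1–BN3, BN5). -/
@[folklore] def YoungTransport : Prop :=
  ∀ K : ℕ, ∃ᶠ n in atTop, ∃ G₁ G₂ : SimpleGraph (Fin n),
    ¬ Nonempty (G₁ ≃g G₂) ∧ YoungEquiv K n G₁ G₂

/-- **EST · entropy support theorem, multinomial form.** For every rate `c` there is a rate `K` such
that EVERY subgroup `H ≤ Sym(Fin n)` of index `≤ 2^{cn}` contains all 3-cycles supported inside one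
class of some labelling of entropy rate `≤ K` — i.e. `∏ᵢ Alt(classᵢ) ≤ H` (classes of size `≤ 2`
contribute nothing: they are the classical "support"). The regime `index < C(n,k)`, one big class, is
Dixon–Mortimer Thm 5.2B (PROVED in tree: `alternating_fixing_le_of_index_lt_choose`); the general
case is the entropy line's `stub_est` (from Praeger–Saxl / Maróti or Bochert, the latter PROVED in
tree) followed by Stirling (`log₂ multinomial ≤ Σ|Bᵢ|log₂(n/|Bᵢ|) + O(log n)`); the `∃ K` after `∀ c`
absorbs small `n` (the hyperoctahedral `S₂ ≀ S_{n/2}` has index `2^{Θ(n log n)}`). -/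
@[folklore] def EntropySupport : Prop :=
  ∀ c : ℕ, ∃ K : ℕ, ∀ (n : ℕ) (H : Subgroup (Equiv.Perm (Fin n))), H.index ≤ 2 ^ (c * n) →
    ∃ μ : Fin n → ℕ, LowEntropy K n μ ∧
      ∀ u v w : Fin n, u ≠ v → v ≠ w → u ≠ w → μ u = μ v → μ v = μ w →
        Equiv.swap u v * Equiv.swap v w ∈ H

/-- **D1 · refinement bound (soundness of the relaxation for window circuits).** For every size
rate `c` there are `K, n₀` such that for `n ≥ n₀` a Young-positive plan at rate `K` between `G₁` and
`G₂` forces EVERY `Sym(Fin n)`-symmetric `tcBasis` circuit with at most `2^{cn}` gates to take the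
same value on the two adjacency matrices. -/
@[folklore] def RefinementBound : Prop :=
  ∀ c : ℕ, ∃ K n₀ : ℕ, ∀ n : ℕ, n₀ ≤ n → ∀ G₁ G₂ : SimpleGraph (Fin n), YoungEquiv K n G₁ G₂ →
    ∀ C : Circuit (Fin n × Fin n), C.IsOver tcBasis → C.size ≤ 2 ^ (c * n) →
      C.IsSymmetricUnder Set.univ →
        C.eval (fun p : Fin n × Fin n => decide (G₁.Adj p.1 p.2)) =
          C.eval (fun p : Fin n × Fin n => decide (G₂.Adj p.1 p.2))

/-- **S1 · a polynomial-time complete invariant for `Bud`-isomorphism** (verbatim the picked line's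
`completeInvariantFP` = its S1b applied to S1a): there is `F ∈ FP` such that for all large `m` and
all `m × m` Boolean matrices `x, y`, `F` agrees on the codes of `Gr x`, `Gr y` iff some
`ρ ∈ Bud(m,⌊log₂ m⌋)` carries `Gr x` onto `Gr y`. -/
@[folklore] def CompleteInvariant : Prop :=
  ∃ F ∈ FP, ∃ m₀ : ℕ, ∀ m : ℕ, m₀ ≤ m → ∀ x y : Fin m × Fin m → Bool,
    (F (encodingGraph.encode ⟨m, SimpleGraph.fromRel fun u v => x (u, v) = true⟩) =
        F (encodingGraph.encode ⟨m, SimpleGraph.fromRel fun u v => y (u, v) = true⟩) ↔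
      ∃ ρ ∈ pointStabiliserBudget m (Nat.log 2 m),
        (SimpleGraph.fromRel fun u v => x (ρ u, ρ v) = true) =
          (SimpleGraph.fromRel fun u v => y (u, v) = true))

/-! ## Certificates (the LP / Farkas layer; statements only — for the lead and the cdisprove seat) -/

/-- One round of colour refinement on the labelled Young scheme at rate `K`: the new colour of a
low-entropy labelling `μ` of `G` is (old colour, the multiset over all low-entropy `μ'` of
(overlap type of `(μ, μ')`, old colour of `μ'`)). We only need its abstract form: a COLOURING is any
function of (graph, labelling); `Refine` produces the next one. Overlap types `(|μ⁻¹ i ∩ μ'⁻¹ j|)ᵢⱼ`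
are input-independent — the `Sym(n)`-orbitals of the scheme. -/
@[folklore] def overlapType {n : ℕ} (μ μ' : Fin n → ℕ) (i j : ℕ) : ℕ :=
  (univ.filter fun u : Fin n => μ u = i ∧ μ' u = j).card

/-- A colouring of labellings is **stable** for `(G₁, G₂)` at rate `K` if labellings of equal colour
have equal quotient labels and, for every colour class and overlap type, equally many low-entropy
neighbours of each colour (an equitable partition of the labelled scheme, common to both graphs). -/
@[folklore] def IsStableColouring (K n : ℕ) (G₁ G₂ : SimpleGraph (Fin n))
    (col : Bool → (Fin n → ℕ) → ℕ) : Prop :=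
  (∀ (b b' : Bool) (μ μ' : Fin n → ℕ), col b μ = col b' μ' →
      quot (bif b then G₁ else G₂) μ = quot (bif b' then G₁ else G₂) μ') ∧
  ∀ (b b' : Bool) (μ μ' : Fin n → ℕ), LowEntropy K n μ → LowEntropy K n μ' → col b μ = col b' μ' →
    ∀ (t : ℕ → ℕ → ℕ) (γ : ℕ),
      (univ.filter fun ν : Fin n → Fin n => LowEntropy K n (fun u => (ν u : ℕ)) ∧
          overlapType μ (fun u => (ν u : ℕ)) = t ∧ col b (fun u => (ν u : ℕ)) = γ).card =
      (univ.filter fun ν : Fin n → Fin n => LowEntropy K n (fun u => (ν u : ℕ)) ∧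
          overlapType μ' (fun u => (ν u : ℕ)) = t ∧ col b' (fun u => (ν u : ℕ)) = γ).card

/-- **CR-equivalence of the labelled Young schemes**: some common stable colouring gives the two
graphs the same colour histogram over low-entropy labellings (with values in `Fin n`, which is all
shapes up to renaming of labels). -/
@[folklore] def SchemeCREquiv (K n : ℕ) (G₁ G₂ : SimpleGraph (Fin n)) : Prop :=
  ∃ col : Bool → (Fin n → ℕ) → ℕ, IsStableColouring K n G₁ G₂ col ∧
    ∀ γ : ℕ, (univ.filter fun ν : Fin n → Fin n =>
        LowEntropy K n (fun u => (ν u : ℕ)) ∧ col true (fun u => (ν u : ℕ)) = γ).card =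
      (univ.filter fun ν : Fin n → Fin n =>
        LowEntropy K n (fun u => (ν u : ℕ)) ∧ col false (fun u => (ν u : ℕ)) = γ).card

/-- **T · transport duality** (card P2; provable now, M/L): a Young-positive signed plan exists iff
the labelled Young schemes are CR-equivalent. (⇐) is the double-centraliser step: a common equitable
partition gives a doubly stochastic `X ≥ 0` on `𝒱_K` commuting with every orbital matrix and
carrying `quot G₂` to `quot G₁`; orbitals span `End_{Sym(n)}(ℚ 𝒱_K)` and `ρ(ℚ[Sym n])` is its own
bicommutant (it is a *-algebra: `ρ(σ)ᵀ = ρ(σ⁻¹)`), so `X = ρ(a)` and `X_{νμ} = mass a μ ν`. (⇒):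
`X = ρ(a)` is doubly stochastic on each shape block, commutes with orbitals, preserves labels; the
coarsest partition it intertwines is equitable (Tinhofer / Ramana–Scheinerman–Ullman, verbatim for
multi-relational vertex-labelled schemes). Not on the proof path of the crux; it is what makes K1 a
feasibility question for ONE explicit polytope with two-sided certificates. -/
@[folklore] def TransportDuality : Prop :=
  ∀ (K n : ℕ) (G₁ G₂ : SimpleGraph (Fin n)), YoungEquiv K n G₁ G₂ ↔ SchemeCREquiv K n G₁ G₂

/-- **D2 · plan or separate** (card P1, the kill-switch direction; provable now, L): for every rate
`K` there is `c` such that two `n`-vertex graphs WITHOUT a Young-positive plan at rate `K` are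
separated by some `Sym(Fin n)`-symmetric `tcBasis` circuit of size `≤ 2^{c(n+1)}` (compile colour
refinement on the scheme: gates `(μ, i, j, threshold)` for the labels, `(μ, μ', round)` for "same
colour", symmetric ranking for canonical colour names; `≤ |𝒱_K| ≤ 2^{(K+1)n}` rounds; equivariant by
construction; then T). Consequence (with `coreFooling_of` read contrapositively): a theorem
"no non-isomorphic pair has a plan at rate `K₀`" (a Young positivstellensatz / finite-target Lovász
theorem) gives `¬ (★)` at `d = c(K₀)`, killing S4 and `stub_witness` of the sibling lines at once. -/
@[folklore] def PlanOrSeparate : Prop :=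
  ∀ K : ℕ, ∃ c : ℕ, ∀ (n : ℕ) (G₁ G₂ : SimpleGraph (Fin n)), ¬ YoungEquiv K n G₁ G₂ →
    ∃ C : Circuit (Fin n × Fin n), C.IsOver tcBasis ∧ C.size ≤ 2 ^ (c * (n + 1)) ∧
      C.IsSymmetricUnder Set.univ ∧
        C.eval (fun p : Fin n × Fin n => decide (G₁.Adj p.1 p.2)) ≠
          C.eval (fun p : Fin n × Fin n => decide (G₂.Adj p.1 p.2))

/-! ## The four stubs -/

/-- **Stub 1 — `stub_youngTransport` (K1; OPEN CORE, hardest, load-bearing).** `YoungTransport`.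
Why plausibly true: it is (★) in dual clothing (K1 ⟹ (★) by Stubs 2–3; (★) ⟹ K1 given D2), and
(★) is the honest open content of the crux (Disproof.lean v8 F7/F8/F11: "resists; probably true;
unprovable by supports"); FOR it — the constraint algebra pins only the isotypics of `a` at partitions
`μ` with first row or first column `≥ n/2^{K+O(1)}` (Young's rule for `⊕_λ M^λ` and its sign twists,
triage r1-2), leaving `2^{n log n - O(Kn)}` free directions for cancellation; AGAINST it — at small `n`
the relaxation is already exact (card's kit calibration, re-derived by triage r1-3: round 0 over the
shapes `(1,n-1), (1,1,n-2), (⌊n/2⌋,⌈n/2⌉)` is a COMPLETE invariant for `n = 4..7`: 11/11, 34/34,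
156/156, 1044/1044 classes), and every gauge-group Duplicator in print dies on one bisection
transporter. Why it might fail: a Young positivstellensatz (positivity on all rate-`K₀` transporters +
mass 1 ⇒ an isomorphism in the support) — then `PlanOrSeparate` fires and S4 / `stub_witness` die with
it. Size XL. Sources: Tinhofer doi:10.1007/bf02240204 (Computing 36, 1986); Ramana–Scheinerman–Ullman
doi:10.1016/0012-365x(94)90241-0; Atserias–Maneva doi:10.1137/120867834; Malkin
doi:10.1016/j.disopt.2014.01.004; Grohe–Otto arXiv:1204.1990; Dell–Grohe–Rattan arXiv:1802.08876;
Cai–Fürer–Immerman doi:10.1007/BF01305232; Dawar–Wilsenach doi:10.4086/toc.2025.v021a014 §6. -/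
theorem stub_youngTransport :
    ∀ K : ℕ, ∃ᶠ n in atTop, ∃ G₁ G₂ : SimpleGraph (Fin n),
      ¬ Nonempty (G₁ ≃g G₂) ∧ YoungEquiv K n G₁ G₂ := by
  sorry

/-- **Stub 2 — `stub_entropySupport` (EST, multinomial form; L; permutation-group theory).**
`EntropySupport`. Why plausibly true: bit accounting, all terms additive in `log₂ |Sym : H|` —
orbit partition costs its multinomial; an imprimitive action with `b` blocks costs `≥ (|O| - b) log₂ b`;
a primitive non-alternating section of degree `d` costs `≥ d (log₂ d - O(1))` (Praeger–Saxl
doi:10.1112/blms/12.4.303 `|G| < 4^d`, Maróti doi:10.1016/s0021-8693(02)00646-4; or Bochert, PROVED in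
tree as `Bochert.factorial_half_le_index`); an alternating section not contained in `H` as
`Alt(Δ) × 1` is diagonally linked (Goursat) and costs `≥ log₂ |Alt Δ|`; declare a class for each
unlinked alternating block section and singletons elsewhere. Checked by hand on Young subgroups,
`S_a ≀ S_b`, `S₂ ≀ S_{n/2}`, `AGL(d,2)`, diagonals, sign-linked products `⊇ Alt × Alt` (why `Alt`).
Follows from the entropy line's `stub_est ∘ stub_primitiveOrderBound` by Stirling. Why it might fail:
only constants (absorbed by `∃ K`). Leans on: Mathlib `Subgroup.index`, `Equiv.swap`, `alternatingGroup`,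
closure of 3-cycles; tree `Literature.GroupTheory.PermutationGroups.alternating_fixing_le_of_index_lt_choose`
(Dixon–Mortimer 5.2B, proved), `PrimitiveGroupOrder.lean` (Praeger–Saxl / Maróti named facts). -/
theorem stub_entropySupport :
    ∀ c : ℕ, ∃ K : ℕ, ∀ (n : ℕ) (H : Subgroup (Equiv.Perm (Fin n))), H.index ≤ 2 ^ (c * n) →
      ∃ μ : Fin n → ℕ, LowEntropy K n μ ∧
        ∀ u v w : Fin n, u ≠ v → v ≠ w → u ≠ w → μ u = μ v → μ v = μ w →
          Equiv.swap u v * Equiv.swap v w ∈ H := by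
  sorry

/-- **Stub 3 — `stub_refinementBound` (D1; L/XL; NEW — the soundness theorem of the relaxation).**
`EntropySupport → RefinementBound`. Plan (the block/Young analogue of Anderson–Dawar 2017 Thm 6, whose
point version is PROVED in tree as `AndersonDawar2016_supports_countingWidth_holds` via
`BijPebbleStrategy.sum_indicator_eq`): (a) the stabiliser `Stab(j) ≤ Sym(Fin n)` of gate `j`
(`Circuit.gateStabiliser Set.univ`) has index `≤ C.size ≤ 2^{cn}` (distinct cosets give distinct gates
`σ j` for ANY automorphisms extending them — the non-rigid orbit–stabiliser count), so EST gives a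
low-entropy SHAPE `μⱼ` with `∏ Alt(classes) ≤ Stab(j)`; (b) `EV_j(G, τ) :=` value of `j` on
`G ∘ (τ × τ)` is constant on right cosets of `∏ Alt` (`IsInducedAut.getD_transcript_eq`), i.e. a
function on the `Alt`-refined scheme point `τ • μⱼ`; (c) CLAIM by induction along the program: for a
plan `a` at rate `K(c)` (covering common refinements `μⱼ ∧ μ_w` of a gate's and a child's shape, the
`2 log₂ n` bits of input wires, and EST's singleton points), `Σ_σ a(σ) · [EV_j(G₁, σ τ) = b] =
[EV_j(G₂, τ) = b]` — the signed plan transports gate values like an isomorphism would; the step is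
the equitable-partition property of the doubly stochastic, orbital-commuting, label-preserving matrix
`X = ρ(a)` applied to the multiset of children values (symmetric gates see only that multiset,
`isSymmetric_of_mem_tcBasis`), exactly as in the proof that fractionally isomorphic graphs are not
distinguished by colour refinement; (d) the output gate is fixed by every automorphism (one-class
shape), so `C.eval (adj G₁) = C.eval (adj G₂)`. Caveats named by the card / triage r1-2 and carried
here: gate ↦ shape must be equivariant (use the canonical maximal Alt-block system of `Stab(j)` and a
`Stab(j)`-orbit of orderings); `Alt` versus `Sym` on blocks evaporates on the scheme (blocks have size
`≥ n/2^{O(K)} ≫` number of singleton parts) — if it did not, strengthen K1 to Young–ALT translates (T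
unchanged). Why it might fail: nothing structural is expected; the unprinted part is (c) with signed
mass (positivity on transporters is exactly what replaces Duplicator's bijections). Sources:
doi:10.1007/s00224-016-9692-2 Thm 6 (= arXiv:1401.1125); doi:10.4086/toc.2025.v021a014 Thms 6.2–6.4;
Tinhofer 1991; Grohe–Otto arXiv:1204.1990 §§3–5 (SA ⟺ C^k template). Leans on: `Circuit.gateStabiliser`,
`Circuit.IsInducedAut.getD_transcript_eq`, `Circuit.IsSymmetricUnder.eval_comp_eq`,
`isSymmetric_of_mem_tcBasis`, `Gate.op_eq_op_of_fn_eq`, Mathlib `doublyStochastic` (Birkhoff: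
`doublyStochastic_eq_convexHull_permMatrix`), `Finset.sum_comm`. -/
theorem stub_refinementBound :
    EntropySupport →
    ∀ c : ℕ, ∃ K n₀ : ℕ, ∀ n : ℕ, n₀ ≤ n → ∀ G₁ G₂ : SimpleGraph (Fin n), YoungEquiv K n G₁ G₂ →
      ∀ C : Circuit (Fin n × Fin n), C.IsOver tcBasis → C.size ≤ 2 ^ (c * n) →
        C.IsSymmetricUnder Set.univ →
          C.eval (fun p : Fin n × Fin n => decide (G₁.Adj p.1 p.2)) =
            C.eval (fun p : Fin n × Fin n => decide (G₂.Adj p.1 p.2)) := by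
  sorry

/-- **Stub 4 — `stub_completeInvariant` (S1 of the picked line; literature debt, SHARED).**
`CompleteInvariant`. Why plausibly true: it is a theorem — Babai–Luks 1983 canonical labelling of the
rank-coloured free part (`g = ⌊log₂ m⌋` vertices, colours = attachment vectors to the ordered part)
in time `2^{O(√(g log g))} = m^{o(1)}` (doi:10.1145/800061.808746 §4; tree named fact
`Literature.Computability.Complexity.babaiLuks1983_canonicalForm`, p74928), composed with the FP
extraction plumbing of the picked line's S1b (`stub_completeInvariantFP_of_canonicalForm`: sub-bricks
RankDict / ExtractBricks / ExtractBricks2 / GraphBridge LANDED, main file landing); once S1b lands this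
stub closes as `stub_completeInvariantFP_of_canonicalForm h` modulo the named fact alone. Why it might
fail: it cannot (known theorem); the risk is only the XL formalisation of a moderately exponential
canoniser. Size: XL (S1a) + 0 (S1b landed). -/
theorem stub_completeInvariant :
    ∃ F ∈ FP, ∃ m₀ : ℕ, ∀ m : ℕ, m₀ ≤ m → ∀ x y : Fin m × Fin m → Bool,
      (F (encodingGraph.encode ⟨m, SimpleGraph.fromRel fun u v => x (u, v) = true⟩) =
          F (encodingGraph.encode ⟨m, SimpleGraph.fromRel fun u v => y (u, v) = true⟩) ↔
        ∃ ρ ∈ pointStabiliserBudget m (Nat.log 2 m),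
          (SimpleGraph.fromRel fun u v => x (ρ u, ρ v) = true) =
            (SimpleGraph.fromRel fun u v => y (u, v) = true)) := by
  sorry

/-! ## Name-keyed aliases of the stub statements (hypotheses of the composition)

`__Registered.stub_X` is the statement of `stub_X` under the registered stub's short name, so that the
native skeleton audit (`#h21_check_skeleton`: hypotheses admissible iff registered obligations / declared
stubs BY NAME, or tagged statements) accepts
`WindowBarrier_of : __Registered.stub_youngTransport → … → WindowBarrier` (device of
`Lines/entropy-support-dichotomy.lean`). The namespace is an implementation-detail name (`__…`) so
that the audit's stubs report resolves each `stub_X` to the sorried THEOREM below, not to its alias. -/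
namespace __Registered

/-- Alias of `YoungTransport` keyed by the registered stub name. -/
@[folklore] abbrev stub_youngTransport : Prop := YoungTransport
/-- Alias of `EntropySupport` keyed by the registered stub name. -/
@[folklore] abbrev stub_entropySupport : Prop := EntropySupport
/-- Alias of the statement of `stub_refinementBound`. -/
@[folklore] abbrev stub_refinementBound : Prop := EntropySupport → RefinementBound
/-- Alias of `CompleteInvariant` keyed by the registered stub name. -/
@[folklore] abbrev stub_completeInvariant : Prop := CompleteInvariant

end __Registered

/-! ## Glue (no `sorry` below this line) -/

/-- An honest isomorphism is a plan: the point mass at `σ₀ : G₂ ≃g G₁` is a Young-positive signed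
transport plan at every rate (sanity check of the directions in `mass` / `quot`; `≡_K` contains `≅`). -/
theorem isYoungPlan_of_iso {K n : ℕ} {G₁ G₂ : SimpleGraph (Fin n)} (σ₀ : G₂ ≃g G₁) :
    IsYoungPlan K n G₁ G₂ (fun σ => if σ = σ₀.toEquiv then 1 else 0) := by
  refine ⟨by simp, fun μ ν _ => ⟨?_, fun hne => ?_⟩⟩
  · simp only [mass]
    exact sum_nonneg fun σ _ => by split_ifs <;> norm_num
  · simp only [mass, sum_ite_eq', mem_filter, mem_univ, true_and]
    rw [if_neg]
    intro hσ
    apply hne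
    have hσ' : ∀ u : Fin n, ν u = μ (σ₀.symm u) := fun u => by
      have := hσ (σ₀.symm u)
      simpa using this
    funext i j
    unfold quot
    refine card_bij (fun p _ => (σ₀.symm p.1, σ₀.symm p.2)) ?_ ?_ ?_
    · rintro ⟨u, v⟩ hp
      simp only [mem_filter, mem_univ, true_and] at hp ⊢
      obtain ⟨hu, hv, hadj⟩ := hp
      exact ⟨by rw [← hσ' u, hu], by rw [← hσ' v, hv], σ₀.symm.map_rel_iff.mpr hadj⟩
    · rintro ⟨u, v⟩ _ ⟨u', v'⟩ _ h
      simp only [Prod.mk.injEq] at h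
      obtain ⟨h₁, h₂⟩ := h
      rw [σ₀.symm.injective h₁, σ₀.symm.injective h₂]
    · rintro ⟨u, v⟩ hp
      simp only [mem_filter, mem_univ, true_and] at hp
      obtain ⟨hu, hv, hadj⟩ := hp
      refine ⟨(σ₀ u, σ₀ v), ?_, by simp⟩
      simp only [mem_filter, mem_univ, true_and]
      refine ⟨?_, ?_, σ₀.map_rel_iff.mpr hadj⟩
      · rw [hσ' (σ₀ u), ← hu]; simp
      · rw [hσ' (σ₀ v), ← hv]; simp

/-- `≡_K` contains `≅` (wrapper of `isYoungPlan_of_iso`). -/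
theorem youngEquiv_of_iso {K n : ℕ} {G₁ G₂ : SimpleGraph (Fin n)} (h : Nonempty (G₂ ≃g G₁)) :
    YoungEquiv K n G₁ G₂ :=
  ⟨_, isYoungPlan_of_iso h.some⟩

/-- The constraints bite already at entropy `0` (non-vacuity check): `≡_K` graphs have equal quotient
labels for the ONE-CLASS labelling — the same number of ordered edges — because the transporter of
the one-class labelling to itself is all of `Sym(n)`, of mass `1 ≠ 0`. (Round 0 of the card's filter;
the bisection shapes give the histograms computed in the line card.) -/
theorem quot_const_eq_of_youngEquiv {K n : ℕ} {G₁ G₂ : SimpleGraph (Fin n)}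
    (h : YoungEquiv K n G₁ G₂) : quot G₁ (fun _ => 0) = quot G₂ (fun _ => 0) := by
  obtain ⟨a, hmass, hpos⟩ := h
  have hlow : LowEntropy K n (fun _ : Fin n => (0 : ℕ)) := by
    unfold LowEntropy
    rcases Nat.eq_zero_or_pos n with rfl | hn
    · simp
    · have huniv : (univ : Finset (Fin n)).Nonempty := univ_nonempty_iff.mpr ⟨⟨0, hn⟩⟩
      rw [image_const huniv, prod_singleton]
      have hcs : classSize (fun _ : Fin n => (0 : ℕ)) 0 = n := by simp [classSize]
      rw [hcs]
      exact Nat.le_mul_of_pos_left _ (by positivity)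
  have h1 : mass a (fun _ : Fin n => (0 : ℕ)) (fun _ => 0) = 1 := by
    simp [mass, hmass]
  by_contra hne
  have h0 := (hpos _ _ hlow).2 hne
  rw [h1] at h0
  exact one_ne_zero h0

/-- **K1 + D1 ⇒ (★)** — the square-symmetric core, in EXACTLY the form of the hypothesis of the
landed `Theorems.stub_coreReduction`: given `d`, D1 supplies `K, n₀`; K1 at `K` supplies non-isomorphic
`≡_K`-pairs frequently, and eventually `n ≥ n₀`. -/
theorem coreFooling_of (hYT : YoungTransport) (hRB : RefinementBound) :
    ∀ d : ℕ, ∃ᶠ g in atTop, ∃ G₁ G₂ : SimpleGraph (Fin g), ¬ Nonempty (G₁ ≃g G₂) ∧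
      ∀ C : Circuit (Fin g × Fin g), C.IsOver tcBasis → C.size ≤ 2 ^ (d * g) →
        C.IsSymmetricUnder Set.univ →
          C.eval (fun p : Fin g × Fin g => decide (G₁.Adj p.1 p.2)) =
            C.eval (fun p : Fin g × Fin g => decide (G₂.Adj p.1 p.2)) := by
  intro d
  obtain ⟨K, n₀, hK⟩ := hRB d
  refine ((hYT K).and_eventually (eventually_ge_atTop n₀)).mono ?_
  rintro n ⟨⟨G₁, G₂, hne, hYE⟩, hn⟩
  exact ⟨G₁, G₂, hne, fun C hO hs hS => hK n hn G₁ G₂ hYE C hO hs hS⟩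

/-- A gate-free input circuit `x ↦ x q` is symmetric under any set of permutations fixing both
coordinates of `q`. [folklore; verbatim from `Lines/canonical-form-completeness.lean`] -/
theorem input_isSymmetricUnder {m : ℕ} (Γ : Set (Equiv.Perm (Fin m))) (q : Fin m × Fin m)
    (hq : ∀ ρ ∈ Γ, ρ q.1 = q.1 ∧ ρ q.2 = q.2) :
    (Circuit.input q).IsSymmetricUnder Γ := by
  intro ρ hρ
  refine ⟨1, ?_, ?_⟩
  · show Sum.inl (ρ q.1, ρ q.2) = Sum.inl q
    rw [(hq ρ hρ).1, (hq ρ hρ).2]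
  · intro j
    exact absurd j.2 (Nat.not_lt_zero _)

/-- **The picked line's composition `S1 → S2 → S3 → S4 → WindowBarrier`** (sorry-free; verbatim
`windowBarrier_restated` of `Lines/canonical-form-completeness.lean`, reproduced so that this skeleton
depends only on LANDED Theorems files): `L` from S2 applied to the `F` of S1; given `p`, S4 at `p + 2`
yields, frequently in `m` (and eventually `m ≥ m₁`), a fooling pair `(x, y)`; it agrees on the header
(input wires are symmetric circuits of size `0`), so S2 gives a header `h` on which `L` separates the
overwritten pair; a symmetric circuit of size `≤ p m` for the slice would, by S3, give one of size
`≤ p m + 2` for the overwritten slice, which the pair fools — contradiction. -/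
theorem windowBarrier_restated
    (h₁ : ∃ F ∈ FP, ∃ m₀ : ℕ, ∀ m : ℕ, m₀ ≤ m → ∀ x y : Fin m × Fin m → Bool,
      (F (encodingGraph.encode ⟨m, SimpleGraph.fromRel fun u v => x (u, v) = true⟩) =
          F (encodingGraph.encode ⟨m, SimpleGraph.fromRel fun u v => y (u, v) = true⟩) ↔
        ∃ ρ ∈ pointStabiliserBudget m (Nat.log 2 m),
          (SimpleGraph.fromRel fun u v => x (ρ u, ρ v) = true) =
            (SimpleGraph.fromRel fun u v => y (u, v) = true)))
    (h₂ : ∀ F ∈ FP, ∀ m₀ : ℕ,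
      (∀ m : ℕ, m₀ ≤ m → ∀ x y : Fin m × Fin m → Bool,
        (F (encodingGraph.encode ⟨m, SimpleGraph.fromRel fun u v => x (u, v) = true⟩) =
            F (encodingGraph.encode ⟨m, SimpleGraph.fromRel fun u v => y (u, v) = true⟩) ↔
          ∃ ρ ∈ pointStabiliserBudget m (Nat.log 2 m),
            (SimpleGraph.fromRel fun u v => x (ρ u, ρ v) = true) =
              (SimpleGraph.fromRel fun u v => y (u, v) = true))) →
      ∃ L ∈ Classes.P, ∃ t : ℕ → ℕ, ∃ m₁ : ℕ,
        (∀ m : ℕ, ∀ ρ ∈ pointStabiliserBudget m (Nat.log 2 m), ∀ x : Fin m × Fin m → Bool,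
          encodingGraph.encode ⟨m, SimpleGraph.fromRel fun u v => x (ρ u, ρ v) = true⟩ ∈ L ↔
            encodingGraph.encode ⟨m, SimpleGraph.fromRel fun u v => x (u, v) = true⟩ ∈ L) ∧
        (∀ m : ℕ, m₁ ≤ m → t m + Nat.log 2 m ≤ m) ∧
        (∀ m : ℕ, m₁ ≤ m → ∀ x y : Fin m × Fin m → Bool,
          (∀ q : Fin m × Fin m, (q.1 : ℕ) < t m → (q.2 : ℕ) < t m → x q = y q) →
          (¬ ∃ ρ ∈ pointStabiliserBudget m (Nat.log 2 m),
              (SimpleGraph.fromRel fun u v => x (ρ u, ρ v) = true) =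
                (SimpleGraph.fromRel fun u v => y (u, v) = true)) →
          ∃ h : Fin m × Fin m → Bool,
            ¬ (encodingGraph.encode ⟨m, SimpleGraph.fromRel fun u v =>
                    (if (u : ℕ) < t m ∧ (v : ℕ) < t m then h (u, v) else x (u, v)) = true⟩ ∈ L ↔
                encodingGraph.encode ⟨m, SimpleGraph.fromRel fun u v =>
                    (if (u : ℕ) < t m ∧ (v : ℕ) < t m then h (u, v) else y (u, v)) = true⟩ ∈ L)))
    (h₃ : ∀ (m t s : ℕ) (Γ : Set (Equiv.Perm (Fin m))),
      (∀ ρ ∈ Γ, ∀ i : Fin m, (i : ℕ) < t → ρ i = i) →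
      ∀ (f : (Fin m × Fin m → Bool) → Bool) (h : Fin m × Fin m → Bool),
        HasSymCircuit tcBasis Γ s f →
        HasSymCircuit tcBasis Γ (s + 2)
          (fun x => f (fun q => if (q.1 : ℕ) < t ∧ (q.2 : ℕ) < t then h q else x q)))
    (h₄ : ∀ p : Polynomial ℕ, ∃ᶠ m in atTop, ∃ x y : Fin m × Fin m → Bool,
      (¬ ∃ ρ ∈ pointStabiliserBudget m (Nat.log 2 m),
          (SimpleGraph.fromRel fun u v => x (ρ u, ρ v) = true) =
            (SimpleGraph.fromRel fun u v => y (u, v) = true)) ∧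
      ∀ C : Circuit (Fin m × Fin m), C.IsOver tcBasis → C.size ≤ p.eval m →
        C.IsSymmetricUnder (pointStabiliserBudget m (Nat.log 2 m)) → C.eval x = C.eval y) :
    ∃ L ∈ Classes.P,
      (∀ m : ℕ, ∀ ρ ∈ pointStabiliserBudget m (Nat.log 2 m), ∀ x : Fin m × Fin m → Bool,
        encodingGraph.encode ⟨m, SimpleGraph.fromRel fun u v => x (ρ u, ρ v) = true⟩ ∈ L ↔
          encodingGraph.encode ⟨m, SimpleGraph.fromRel fun u v => x (u, v) = true⟩ ∈ L) ∧
      ∀ p : Polynomial ℕ, ∃ᶠ m in atTop,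
        ¬ HasSymCircuit tcBasis (pointStabiliserBudget m (Nat.log 2 m)) (p.eval m)
            (fun x : Fin m × Fin m → Bool =>
              decide (encodingGraph.encode ⟨m, SimpleGraph.fromRel fun u v => x (u, v) = true⟩ ∈ L)) := by
  obtain ⟨F, hF, m₀, hcomp⟩ := h₁
  obtain ⟨L, hLP, t, m₁, hinv, hfit, hsep⟩ := h₂ F hF m₀ hcomp
  refine ⟨L, hLP, hinv, fun p => ?_⟩
  have hfool := h₄ (p + 2)
  refine (hfool.and_eventually (eventually_ge_atTop m₁)).mono ?_
  rintro m ⟨⟨x, y, hniso, hxy⟩, hm⟩ hsym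
  -- `Bud` fixes the header pointwise
  have hfix : ∀ ρ ∈ pointStabiliserBudget m (Nat.log 2 m), ∀ i : Fin m, (i : ℕ) < t m → ρ i = i := by
    intro ρ hρ i hi
    have hle := hfit m hm
    exact hρ i (by omega)
  -- the fooling pair agrees on the header block (input wires there are symmetric circuits of size 0)
  have hagree : ∀ q : Fin m × Fin m, (q.1 : ℕ) < t m → (q.2 : ℕ) < t m → x q = y q := by
    intro q hq₁ hq₂
    have hO : (Circuit.input q).IsOver tcBasis := by
      intro g hg
      simp [Circuit.input] at hg
    have hS : (Circuit.input q).IsSymmetricUnder (pointStabiliserBudget m (Nat.log 2 m)) :=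
      input_isSymmetricUnder _ q fun ρ hρ => ⟨hfix ρ hρ q.1 hq₁, hfix ρ hρ q.2 hq₂⟩
    have hsz : (Circuit.input q).size ≤ (p + 2).eval m := by
      rw [Circuit.size_input]
      exact Nat.zero_le _
    simpa using hxy (Circuit.input q) hO hsz hS
  obtain ⟨h, hh⟩ := hsep m hm x y hagree hniso
  obtain ⟨C, hCO, hCs, hCsym, hCcomp⟩ :=
    h₃ m (t m) (p.eval m) (pointStabiliserBudget m (Nat.log 2 m)) hfix _ h hsym
  apply hh
  have hsize : C.size ≤ (p + 2).eval m := by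
    have : (p + 2 : Polynomial ℕ).eval m = p.eval m + 2 := by
      simp [Polynomial.eval_add]
    omega
  have hev := hxy C hCO hsize hCsym
  rw [hCcomp x, hCcomp y] at hev
  exact decide_eq_decide.mp hev

/-! ### The composition (concludes the crux BY NAME) -/

/-- **`WindowBarrier` from the four stubs.** K1 and D1 (from EST) give the square-symmetric core (★)
(`coreFooling_of`); the landed `Theorems.stub_coreReduction` plants it on the free part (S4); the
picked line's composition with S1 (`stub_completeInvariant`), landed S2
(`Theorems.stub_addressableBitLanguage`) and landed S3 (`Theorems.stub_headerHardwiring`) gives the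
crux over the named vocabulary, which is the route's inline `let Sym … HasSym … Bud … Gr …` by
definitional unfolding (`Circuit.isSymmetricUnder_iff` is `Iff.rfl`). -/
theorem WindowBarrier_of (h₁ : __Registered.stub_youngTransport)
    (h₂ : __Registered.stub_entropySupport) (h₃ : __Registered.stub_refinementBound)
    (h₄ : __Registered.stub_completeInvariant) :
    Summit.PneNP.PneNP.Theses.SymmetryBudget.WindowBarrier := by
  have hcore := coreFooling_of h₁ (h₃ h₂)
  have hS4 := _root_.Summit.PneNP.PneNP.Theorems.stub_coreReduction hcore
  have H := windowBarrier_restated h₄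
    _root_.Summit.PneNP.PneNP.Theorems.stub_addressableBitLanguage
    _root_.Summit.PneNP.PneNP.Theorems.stub_headerHardwiring hS4
  exact H

/-- Wiring check: the registered stubs feed `WindowBarrier_of` as stated (sorries only via the stubs). -/
example : Summit.PneNP.PneNP.Theses.SymmetryBudget.WindowBarrier :=
  WindowBarrier_of stub_youngTransport stub_entropySupport stub_refinementBound stub_completeInvariant

end Summit.PneNP.PneNP.Cruxes.WindowBarrier.YoungTransportPlan

end
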